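import Literature.NumberTheory.EllipticCurves.ModularCurve
import Literature.NumberTheory.EllipticCurves.GlobalMinimalModel
import Literature.NumberTheory.EllipticCurves.GaloisAction
import Literature.NumberTheory.EllipticCurves.SemistabilityDefect
import Literature.NumberTheory.DiophantineGeometry.Conductor
import HarnessLib
import HarnessLib.Audit.Tags

/-!
# Candidate E-desc-4: the SEMISTABILITY-DEFECT DEGREE LAW at tame primes `q ≥ 5`
# (`SemistabilityDefectDegreeLawFive`)
# — cell `bsd-f2-manin` (D-0131 (3) frontier: the Manin constant at additive primes). `@[conjecture]`
# leaf (NOTHING asserted; definition only).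

HONEST FRAMING. LENS = descent / visibility / Néron models under additive base change (planner
`bsd-f2-manin-desc` g1, HOME `run/shared/lean/pub/bsd-f2-manin/MEMO-desc.md` §§7–16), Prop VERBATIM
from HOME/desc/Sketch-desc-g1.lean (audited text 1d824c449d157e97; farm rc 0). Binder block = the landed
`ManinCongruenceDefectLaw` / `ComponentExponentDegreeLaw` (globally minimal `W`, datum `D` at the
conductor level with the lattice clause `Λ_W = c·Λ_f` and of minimal degree among the data at level `N`
with the same newform, i.e. `D.deg = deg φ₀` of the optimal curve). The local invariant is Kraus's
semistability defect `e_q(W) = W.semistabilityDefectAt q` (tree, `Literature/…/SemistabilityDefect.lean`: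
`= 1` at a semistable prime, `2` at a potentially multiplicative additive prime, `12/gcd(12, v_qΔ_min)`
at a potentially good prime `q ≥ 5`; junk value `0` makes the clause empty).

THIS ROW (E-desc-4 = SDL₅): for every prime `q ≥ 5` and every prime `ℓ` with `E[ℓ]` irreducible,
`ℓ^{v_ℓ(e_q(E))} ∣ deg φ₀`. Its unrestricted form E-desc-4⁺ (all `q`) and the torsion-keyed E-desc-4T
were KILLED by data (planner's own withdrawal 15:48Z and REFUTER-ref1 §R3.4: 48a1 at `q = 2` —
`v₂Δ = 8 ⇒ 3 ∣ e₂`, no 3-isogeny, `m = 2`; 243b1 = [0,0,1,0,2] IV at 3, `e₃ = 12`, `m = 9`; 54b1 II, `m = 2`;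
4T at `q = 5`: 50b1 II, `e₅ = 6`, `#T = 5`, `m = 2`) and are NOT typed (HOME/CANDIDATES.md §F). BC5
WITNESS: planner census (MEMO-desc §§13–16, HOME/desc/addlaw-*.txt) and refuter-1's engine N < 10⁵: SDL₅
0 violations / 116 693 incidences. Refuter verdicts: REF1 **SURVIVES** 2026-08-27T16:22Z (HOME/REFUTER-ref1.md
§R3; crux probes CLEAN); REF2 (HOME/REFUTER-ref2.md, v3 §C″): SPLIT at `q ≥ 5` — II/II* «3 ∣ m»
IN-PRINT-IMPLICIT (CEL on the `χ_{q*}`-twist of type IV*/IV plus the c-free degree ratio `q^{0,±1}`,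
the cell's E-imc-7R), `ℓ = 2` exponent-1 parts IN PRINT (Calegari–Emerton 2009 Thm 1, tree fact
`calegariEmerton_oddModularDegree`), III/III* «4 ∣ m» (0 / 61 786) NOT-IN-PRINT / OPEN-NEW with no known
mechanism — SDL₅'s only tooth beyond CEL ∪ print; on `I_n*` it is weaker than CEL.
-/

noncomputable section

open scoped MatrixGroups ModularForm

open CongruenceSubgroup WeierstrassCurve
  Literature.NumberTheory.EllipticCurves Literature.NumberTheory.EllipticCurves.ModularForms

namespace Summit.BirchSwinnertonDyer.Rank1Residual.ManinAdditive

/-- **Candidate E-desc-4 `SemistabilityDefectDegreeLawFive` (SDL₅; cell bsd-f2-manin; a LAW, partly in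
print, nothing asserted):** for every globally minimal elliptic `W/ℚ` with conductor `N = W.conductorNorm ℤ`,
every `X₀(N)`-parametrisation datum `D` at level `N` with the lattice clause and of minimal degree among
the data at level `N` with the same newform, every prime `q ≥ 5` and every prime `ℓ` at which the mod-`ℓ`
representation of `W` is irreducible: `ℓ ^ v_ℓ(e_q(W)) ∣ D.modularDegree`, `e_q(W) = W.semistabilityDefectAt q`
(Kraus's semistability defect).
[cite: Kraus1990, §1 (the invariant e_q, as restated in Coppola2020 §2; the degree law itself is NOT in
print — cell bsd-f2-manin MEMO-desc.md §§7–16, E-desc-4)] -/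
@[conjecture] def SemistabilityDefectDegreeLawFive : Prop :=
  ∀ (W : WeierstrassCurve ℚ) [W.IsElliptic] [W.IsGloballyMinimal] [NeZero (W.conductorNorm ℤ)]
    (D : ModularParametrizationData W (W.conductorNorm ℤ)),
    (∀ z ∈ D.L.lattice, ∃ w ∈ periodLattice D.f, z = D.c * w) →
    (∀ (W' : WeierstrassCurve ℚ) [W'.IsElliptic]
        (D' : ModularParametrizationData W' (W.conductorNorm ℤ)),
        D'.f = D.f → D.modularDegree ≤ D'.modularDegree) →
    ∀ (q ℓ : ℕ), q.Prime → 5 ≤ q → ℓ.Prime → W.HasIrreducibleModPGaloisRep ℓ →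
      ℓ ^ padicValNat ℓ (W.semistabilityDefectAt q) ∣ D.modularDegree

end Summit.BirchSwinnertonDyer.Rank1Residual.ManinAdditive

end
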